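import Summits.NavierStokesRegularity.NavierStokesRegularity.Theses.HardyPointSink
import Literature.Analysis.FluidPDE.LocalTypeILiouville
import Literature.Analysis.FluidPDE.TsaiSelfSimilarBounded

/-!
# Route HardyPointSink — crux `NoHardyTypeIAncient` (stmt-NavierStokesRegularity-7980), line `birth`:
# certificate — backward self-similar witnesses are excluded (Tsai 1998)

Summit-side proof file (certificate sub-goal of the registered skeleton
`Cruxes/NoHardyTypeIAncient/Lines/birth.lean`, lead c4). A hypothetical witness `(u, p, G)` of the
crux `HardyPointSink.NoHardyTypeIAncient` which is **backward self-similar about some blow-up time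
`T`** — `u(t) = lerayBackward a T U t` for `t < 0`, with `(U, P)` a (pointwise `C²`) Leray
profile, `IsLerayProfile 1 a U P`, `a > 0`, `T` arbitrary — does not exist: the velocity bound of
the class bounds the profile `U` (read off one slice `t₀ < min T 0`), Tsai 1998 Thm 1 (`q = ∞`;
tree THEOREM `tsai_selfsimilar_bounded_holds`) makes `U` constant, hence every slice of `u` is
spatially constant, which `𝐈 < ∞` and non-triviality forbid (`not_ae_slice_const_of_abTypeIBound`,
Albritton–Barker 2019 §1). Neither the Hardy bound nor mildness nor suitability is used.

## References

* T.-P. Tsai, Arch. Rational Mech. Anal. 143 (1998), Thm 1.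
* J. Nečas, M. Růžička, V. Šverák, Acta Math. 176 (1996), Thm 1.
* D. Albritton, T. Barker, J. Math. Fluid Mech. 21 (2019) no. 43 = arXiv:1811.00502, §1.
-/

noncomputable section

set_option linter.dupNamespace false

open MeasureTheory Set Function Filter TopologicalSpace
open scoped ENNReal NNReal Topology

namespace Summit.NavierStokesRegularity.NavierStokesRegularity.Theorems

open Literature.Analysis.FluidPDE

/-- **Certificate `hardyPointSink_cert_selfSimilar`: no backward self-similar witness.** If
`G` is a weak spatial gradient of `u` on the slab `(−∞, 0) × ℝ³`, `u` is not a.e. zero there,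
`𝐈(ℝ³ × ℝ₋) = typeIBound (Iio 0 ×ˢ univ) u p G < ∞`, `u` is a bounded ancient mild solution
(only its `L^∞` bound is used), and `u(t) = lerayBackward a T U t` for all `t < 0` with
`(U, P)` a Leray profile (`IsLerayProfile 1 a U P`, `a > 0`), then `False`: `U` is bounded (from
the slice `t₀ = min T 0 − 1`), hence constant by Tsai 1998 Thm 1, `q = ∞`
(`tsai_selfsimilar_bounded_holds`), so every slice of `u` is constant, contradicting
`not_ae_slice_const_of_abTypeIBound`. [cite: Tsai1998, Thm 1 (p. 31)] -/
theorem hardyPointSink_cert_selfSimilar :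
    ∀ (u : ℝ → EuclideanSpace ℝ (Fin 3) → EuclideanSpace ℝ (Fin 3))
      (p : ℝ → EuclideanSpace ℝ (Fin 3) → ℝ)
      (G : ℝ → EuclideanSpace ℝ (Fin 3) → EuclideanSpace ℝ (Fin 3) →L[ℝ] EuclideanSpace ℝ (Fin 3)),
      Literature.Analysis.FluidPDE.HasWeakSpatialGradientOn
        (Literature.Analysis.FluidPDE.slab (EuclideanSpace ℝ (Fin 3)) (Iio 0) isOpen_Iio) u G →
      ¬ (uncurry u =ᵐ[volume.restrict
        (Iio (0 : ℝ) ×ˢ (univ : Set (EuclideanSpace ℝ (Fin 3))))] 0) →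
      Literature.Analysis.FluidPDE.typeIBound
        (Iio (0 : ℝ) ×ˢ (univ : Set (EuclideanSpace ℝ (Fin 3)))) u p G < ⊤ →
      Literature.Analysis.FluidPDE.IsBoundedAncientMildSolution 1 u →
      (∃ (a T : ℝ) (U : EuclideanSpace ℝ (Fin 3) → EuclideanSpace ℝ (Fin 3))
          (P : EuclideanSpace ℝ (Fin 3) → ℝ),
        0 < a ∧ Literature.Analysis.FluidPDE.IsLerayProfile 1 a U P ∧
        ∀ t < 0, u t = Literature.Analysis.FluidPDE.lerayBackward a T U t) → False := by
  intro u p G hG hne hI hu hss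
  obtain ⟨a, T, U, P, ha, hprof, hss⟩ := hss
  obtain ⟨C, hC⟩ := hu.2
  -- one honest slice `t₀ < min T 0` bounds the profile
  set t₀ : ℝ := min T 0 - 1 with ht₀def
  have ht₀0 : t₀ < 0 := by have := min_le_right T 0; linarith
  have ht₀T : t₀ < T := by have := min_le_left T 0; linarith
  set s : ℝ := Real.sqrt (2 * a * (T - t₀)) with hsdef
  have hspos : 0 < s := Real.sqrt_pos.2 (by nlinarith)
  have hUb : ∀ y, ‖U y‖ ≤ s * C := by
    intro y
    have h1 : u t₀ (s • y) = s⁻¹ • U y := by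
      rw [hss t₀ ht₀0, lerayBackward_apply, smul_smul, inv_mul_cancel₀ hspos.ne', one_smul]
    have h2 : U y = s • u t₀ (s • y) := by
      rw [h1, smul_smul, mul_inv_cancel₀ hspos.ne', one_smul]
    rw [h2, norm_smul, Real.norm_of_nonneg hspos.le]
    exact mul_le_mul_of_nonneg_left (hC t₀ ht₀0 _) hspos.le
  -- Tsai 1998, Thm 1 (`q = ∞`): the profile is constant
  obtain ⟨c, hc⟩ := tsai_selfsimilar_bounded_holds one_pos ha hprof ⟨s * C, hUb⟩
  -- hence every slice of `u` is constant
  have hconst : ∀ᵐ t ∂(volume.restrict (Iio (0 : ℝ))),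
      ∃ b : EuclideanSpace ℝ (Fin 3), u t =ᵐ[volume] fun _ => b := by
    filter_upwards [ae_restrict_mem measurableSet_Iio] with t ht
    refine ⟨(Real.sqrt (2 * a * (T - t)))⁻¹ • c, Filter.EventuallyEq.of_eq ?_⟩
    funext x
    rw [hss t ht, lerayBackward_apply, hc]
  exact not_ae_slice_const_of_abTypeIBound hG.locallyIntegrableOn.aestronglyMeasurable hne hI hconst

/-- **The crux restricted to backward self-similar witnesses holds** (the negand of
`HardyPointSink.NoHardyTypeIAncient` with the self-similarity clause added).
[cite: Tsai1998, Thm 1 (p. 31)] -/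
theorem hardyPointSink_noHardyTypeIAncient_selfSimilar :
    ¬ ∃ (u : ℝ → EuclideanSpace ℝ (Fin 3) → EuclideanSpace ℝ (Fin 3))
        (p : ℝ → EuclideanSpace ℝ (Fin 3) → ℝ)
        (G : ℝ → EuclideanSpace ℝ (Fin 3) → EuclideanSpace ℝ (Fin 3) →L[ℝ] EuclideanSpace ℝ (Fin 3)),
      (∀ t < 0, AEStronglyMeasurable (u t) volume) ∧
      Literature.Analysis.FluidPDE.IsBoundedAncientMildSolution 1 u ∧
      Literature.Analysis.FluidPDE.IsSuitableWeakSolutionOn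
        (Literature.Analysis.FluidPDE.slab (EuclideanSpace ℝ (Fin 3)) (Iio 0) isOpen_Iio) 1 0 u p ∧
      Literature.Analysis.FluidPDE.HasWeakSpatialGradientOn
        (Literature.Analysis.FluidPDE.slab (EuclideanSpace ℝ (Fin 3)) (Iio 0) isOpen_Iio) u G ∧
      ¬ (uncurry u =ᵐ[volume.restrict
        (Iio (0 : ℝ) ×ˢ (univ : Set (EuclideanSpace ℝ (Fin 3))))] 0) ∧
      Literature.Analysis.FluidPDE.typeIBound
        (Iio (0 : ℝ) ×ˢ (univ : Set (EuclideanSpace ℝ (Fin 3)))) u p G < ⊤ ∧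
      (∃ K : ℝ≥0, ∀ x₀ : EuclideanSpace ℝ (Fin 3), ∀ᵐ t ∂(volume.restrict (Iio (0 : ℝ))),
        ∫⁻ x, ‖u t x‖ₑ ^ 2 / ‖x - x₀‖ₑ ≤ K) ∧
      (∃ (a T : ℝ) (U : EuclideanSpace ℝ (Fin 3) → EuclideanSpace ℝ (Fin 3))
          (P : EuclideanSpace ℝ (Fin 3) → ℝ),
        0 < a ∧ Literature.Analysis.FluidPDE.IsLerayProfile 1 a U P ∧
        ∀ t < 0, u t = Literature.Analysis.FluidPDE.lerayBackward a T U t) := by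
  rintro ⟨u, p, G, -, hu, -, hG, hne, hI, -, hss⟩
  exact hardyPointSink_cert_selfSimilar u p G hG hne hI hu hss

end Summit.NavierStokesRegularity.NavierStokesRegularity.Theorems

end
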